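import Summits.CriticalPhenomena.PercolationContinuityZ3.Theorems.PercNearOneGluingNoHeavyLowerTailSunflowerMultiPetalKempeMarkedClasses
import HarnessLib
import HarnessLib.Audit

/-!
# `NoHeavyLowerTail` (crux stmt-CriticalPhenomena-4575), marked-multigraph layer: the ACTIVE-VERTEX MEASURE and the TERMINAL-ISOLATED IDENTITY
# `9·T(K;u,v) = Q(L⁺ᵘ) + Q(L⁺ᵛ)` (the last two ingredients of the Lemma-B induction)

Support file (seat `prim-l12-p2` gen 49; `--supports stmt-CriticalPhenomena-4575`; continuation of `…KempeMarkedClasses` (p608443) and `…KempeMarkedFree` (p607944)).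
No `sorry`; nothing is asserted about the crux.  Memo: run/shared/lean/prim/prim-l12/prim-l12-p2/PROOF-LEMMA-B-MARKED-MULTIGRAPHS-g47.md §3.

* `active` (marked or non-isolated vertices) — the induction measure; it strictly drops under `isolate` of an active vertex and under `peelContract x S u`
  (`active_isolate_subset`, `active_peelContract_subset`, `active_addMark_subset`);
* colour symmetry at a vertex (`sum_pin_colour_eq`, `QcolM_eq_three_mul_pin`) and **`nine_mul_TfunM_eq`**: if the terminals `u, v` are unmarked and joined to no
  other vertex then `9·T(K;u,v) = Q(L⁺ᵘ) + Q(L⁺ᵛ)` with `L = K` minus the `u–v` edges and `L⁺ʷ = L` with one mark at `w` (memo §3 (c): the colour-symmetric form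
  of `Σ f = (2/3)(Q + N₁₁₁)`, via `fC t = lbW (t + e₀) + lbW (t + e₁)`).
-/

namespace Summit.CriticalPhenomena.PercolationContinuityZ3.Theorems.SunflowerPartition.Kempe

open Finset

/-- Any colour can be moved to any other by a colour permutation. (finite check) [this work] -/
theorem exists_colourPerm_one : ∀ c c' : Fin 3, ∃ θ θ' : Fin 3 → Fin 3, θ c = c' ∧ (∀ d, θ' (θ d) = d) ∧ (∀ d, θ (θ' d) = d) := by
  decide

namespace MGraph

variable {V : Type*} [Fintype V] [LinearOrder V] (K : MGraph V)

/-! ## Active vertices (the induction measure) -/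

section Active

/-- The ACTIVE vertices: marked or non-isolated. [this work] -/
def active : Finset V := univ.filter fun w => K.mark w ≠ 0 ∨ ∃ z, K.mul w z ≠ 0

omit [LinearOrder V] in
/-- Membership in the active set. [this work] -/
theorem mem_active {w : V} : w ∈ K.active ↔ K.mark w ≠ 0 ∨ ∃ z, K.mul w z ≠ 0 := by
  unfold active; simp

omit [LinearOrder V] in
/-- An endpoint of an edge is active. [this work] -/
theorem mem_active_of_mul_ne_zero {w z : V} (h : K.mul w z ≠ 0) : w ∈ K.active := (K.mem_active).2 (Or.inr ⟨z, h⟩)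

omit [LinearOrder V] in
/-- The other endpoint of an edge is active. [this work] -/
theorem mem_active_of_mul_ne_zero' {w z : V} (h : K.mul z w ≠ 0) : w ∈ K.active :=
  K.mem_active_of_mul_ne_zero (z := z) (by rwa [K.symm])

omit [LinearOrder V] in
/-- A marked vertex is active. [this work] -/
theorem mem_active_of_mark_ne_zero {w : V} (h : K.mark w ≠ 0) : w ∈ K.active := (K.mem_active).2 (Or.inl h)

omit [LinearOrder V] in
/-- A free vertex is not active. [this work] -/
theorem not_mem_active_of_isFree {w : V} (h : K.IsFree w) : w ∉ K.active := by
  rw [mem_active, not_or, not_exists]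
  exact ⟨fun hm => hm h.2, fun z hz => hz (h.1 z)⟩

omit [LinearOrder V] in
/-- An inactive vertex is free. [this work] -/
theorem isFree_of_not_mem_active {w : V} (h : w ∉ K.active) : K.IsFree w := by
  rw [mem_active, not_or, not_exists] at h
  exact ⟨fun z => by have := h.2 z; omega, by have := h.1; omega⟩

/-- Isolating a vertex keeps only old active vertices, and loses the vertex itself. [this work] -/
theorem active_isolate_subset (y : V) : (K.isolate y).active ⊆ K.active.erase y := by
  intro w hw
  rw [mem_erase]
  have hwy : w ≠ y := by
    rintro rfl
    exact (K.isolate w).not_mem_active_of_isFree (K.isFree_isolate_self w) hw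
  refine ⟨hwy, ?_⟩
  rw [mem_active] at hw ⊢
  unfold isolate at hw
  simp only at hw
  rcases hw with h | ⟨z, hz⟩
  · left; simpa [hwy] using h
  · right
    refine ⟨z, ?_⟩
    by_cases hzy : z = y
    · simp [hzy] at hz
    · simpa [hwy, hzy] using hz

/-- Isolating an active vertex strictly decreases the number of active vertices. [this work] -/
theorem card_active_isolate_lt {y : V} (hy : y ∈ K.active) : (K.isolate y).active.card < K.active.card :=
  lt_of_le_of_lt (card_le_card (K.active_isolate_subset y)) (card_erase_lt_of_mem hy)

/-- Isolating never increases the number of active vertices. [this work] -/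
theorem card_active_isolate_le (y : V) : (K.isolate y).active.card ≤ K.active.card :=
  (card_le_card (K.active_isolate_subset y)).trans (card_le_card (erase_subset y _))

/-- The contraction `K.peelContract x S u` (with `u` active in `K`) keeps only old active vertices and loses `x`. [this work] -/
theorem active_peelContract_subset (x u : V) (S : Finset V) (hu : u ∈ K.active) :
    (K.peelContract x S u).active ⊆ K.active.erase x := by
  intro w hw
  rw [mem_erase]
  have hwx : w ≠ x := by
    rintro rfl
    exact (K.peelContract w S u).not_mem_active_of_isFree (K.isFree_peelContract_self w u S) hw
  have hwS : w ∉ S := fun h => (K.peelContract x S u).not_mem_active_of_isFree (K.isFree_peelContract_of_mem x u S h) hw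
  refine ⟨hwx, ?_⟩
  by_cases hwu : w = u
  · rw [hwu]; exact hu
  rw [mem_active] at hw
  rcases hw with h | ⟨z, hz⟩
  · apply K.mem_active_of_mark_ne_zero
    unfold peelContract at h
    simpa [hwx, hwS, hwu] using h
  · unfold peelContract at hz
    simp only at hz
    by_cases hz1 : w = x ∨ z = x ∨ w ∈ S ∨ z ∈ S
    · rw [if_pos hz1] at hz; exact absurd rfl hz
    · rw [if_neg hz1, if_neg (fun h => hwu h.1)] at hz
      by_cases hzu : z = u ∧ w ≠ u
      · rw [if_pos hzu] at hz
        by_cases hmu : K.mul w u = 0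
        · rw [hmu, zero_add] at hz
          obtain ⟨s, -, hs⟩ := exists_ne_zero_of_sum_ne_zero hz
          exact K.mem_active_of_mul_ne_zero hs
        · exact K.mem_active_of_mul_ne_zero hmu
      · rw [if_neg hzu] at hz
        exact K.mem_active_of_mul_ne_zero hz

/-- Extra marks at `w` activate at most `w`. [this work] -/
theorem active_addMark_subset (w : V) (m : ℕ) : (K.addMark w m).active ⊆ insert w K.active := by
  intro z hz
  rw [mem_insert]
  by_cases hzw : z = w
  · exact Or.inl hzw
  right
  rw [mem_active] at hz ⊢
  unfold addMark addAtU at hz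
  simpa [hzw] using hz

end Active

/-! ## The terminal-isolated case: `9·T(K;u,v) = Q(L⁺ᵘ) + Q(L⁺ᵛ)` -/

section TerminalIsolated

/-- Colour symmetry at a vertex: the sum of `lbW(type)` over the colourings with a prescribed colour at `u` does not depend on that colour. [this work] -/
theorem sum_pin_colour_eq (u : V) (c c' : Fin 3) :
    ∑ σ ∈ univ.filter (fun σ : V → Fin 3 => σ u = c), lbW (K.ctypeM σ)
      = ∑ σ ∈ univ.filter (fun σ : V → Fin 3 => σ u = c'), lbW (K.ctypeM σ) := by
  obtain ⟨θ, θ', hθ, h1, h2⟩ := exists_colourPerm_one c c'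
  have hinj : ∀ a b, θ' a = θ' b → a = b := fun a b h => by rw [← h2 a, ← h2 b, h]
  refine sum_nbij' (fun σ w => θ (σ w)) (fun σ w => θ' (σ w)) ?_ ?_ ?_ ?_ ?_
  · intro σ hσ; simp only [mem_filter, mem_univ, true_and] at hσ ⊢; rw [hσ, hθ]
  · intro σ hσ; simp only [mem_filter, mem_univ, true_and] at hσ ⊢; rw [hσ, ← hθ, h1]
  · intro σ _; funext w; exact h1 _
  · intro σ _; funext w; exact h2 _
  · intro σ _; rw [K.ctypeM_comp_perm θ θ' h2 h1 σ, lbW_permCT θ' hinj]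

/-- `Q(K) = 3 · Σ_{σ u = 0} lbW(type σ)`. [this work] -/
theorem QcolM_eq_three_mul_pin (u : V) :
    K.QcolM = 3 * ∑ σ ∈ univ.filter (fun σ : V → Fin 3 => σ u = 0), lbW (K.ctypeM σ) := by
  unfold QcolM
  rw [← sum_fiberwise univ (fun σ : V → Fin 3 => σ u) (fun σ => lbW (K.ctypeM σ))]
  have h : ∀ c : Fin 3, ∑ σ ∈ univ.filter (fun σ : V → Fin 3 => σ u = c), lbW (K.ctypeM σ)
      = ∑ σ ∈ univ.filter (fun σ : V → Fin 3 => σ u = 0), lbW (K.ctypeM σ) := fun c => K.sum_pin_colour_eq u c 0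
  rw [Fin.sum_univ_three, h 0, h 1, h 2]
  ring

/-- **The terminal-isolated identity**: if `u, v` are unmarked and no other vertex is joined to them, then `9·T(K;u,v) = Q(L⁺ᵘ) + Q(L⁺ᵛ)` where `L` is `K` with
`u, v` isolated and `L⁺ʷ` carries one mark at `w`. [this work] -/
theorem nine_mul_TfunM_eq (u v : V) (huv : u ≠ v) (hmu : K.mark u = 0) (hmv : K.mark v = 0)
    (hiso : ∀ w, w ≠ u → w ≠ v → K.mul w u = 0 ∧ K.mul w v = 0) :
    9 * K.TfunM u v = (((K.isolate u).isolate v).addMark u 1).QcolM + (((K.isolate u).isolate v).addMark v 1).QcolM := by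
  set L := (K.isolate u).isolate v with hL
  have htype : ∀ σ : V → Fin 3, σ u = 0 → σ v = 1 → K.ctypeM σ = L.ctypeM σ := by
    intro σ hu hv
    have c1 : ∀ c, K.cntM σ c = (K.isolate u).cntM σ c := by
      intro c
      rw [K.cntM_eq_isolate_add u σ c, hmu, add_zero]
      by_cases hc : σ u = c
      · rw [if_pos hc]
        have : K.linkM u σ c = 0 := by
          unfold linkM
          refine sum_eq_zero fun w _ => ?_
          by_cases hwu : w = u
          · simp [hwu, K.loopless]
          by_cases hwv : w = v
          · rw [if_neg]; rw [hwv, hv, ← hc, hu]; decide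
          rw [K.symm, (hiso w hwu hwv).1]; simp
        rw [this, add_zero]
      · rw [if_neg hc, add_zero]
    have c2 : ∀ c, (K.isolate u).cntM σ c = L.cntM σ c := by
      intro c
      rw [hL, (K.isolate u).cntM_eq_isolate_add v σ c]
      have hm : (K.isolate u).mark v = 0 := by unfold isolate; simp [hmv]
      rw [hm, add_zero]
      by_cases hc : σ v = c
      · rw [if_pos hc]
        have : (K.isolate u).linkM v σ c = 0 := by
          unfold linkM
          refine sum_eq_zero fun w _ => ?_
          have hz : (K.isolate u).mul v w = 0 := by
            by_cases hwu : w = u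
            · unfold isolate; simp [hwu]
            by_cases hwv : w = v
            · rw [hwv]; exact (K.isolate u).loopless v
            unfold isolate; simp only [huv.symm, hwu, or_self, if_false]; rw [K.symm]; exact (hiso w hwu hwv).2
          simp [hz]
        rw [this, add_zero]
      · rw [if_neg hc, add_zero]
    unfold ctypeM
    rw [c1, c1, c1, c2, c2, c2]
  have x0 : xPart 0 (cap3 1, cap3 1, cap3 1) = (1, 0, 0) := by decide
  have x1 : xPart 1 (cap3 1, cap3 1, cap3 1) = (0, 1, 0) := by decide
  have hT : K.TfunM u v = ∑ σ ∈ univ.filter (fun σ : V → Fin 3 => σ u = 0 ∧ σ v = 1), lbW ((L.addMark u 1).ctypeM σ)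
      + ∑ σ ∈ univ.filter (fun σ : V → Fin 3 => σ u = 0 ∧ σ v = 1), lbW ((L.addMark v 1).ctypeM σ) := by
    unfold TfunM
    rw [← sum_add_distrib]
    refine sum_congr rfl fun σ hσ => ?_
    obtain ⟨hu, hv⟩ := (mem_filter.1 hσ).2
    rw [htype σ hu hv, L.ctypeM_addMark u 1 σ, L.ctypeM_addMark v 1 σ, hu, hv, x0, x1]
    rfl
  have hfree_v : (L.addMark u 1).IsFree v := isFree_addMark _ u 1 ((K.isolate u).isFree_isolate_self v) huv.symm
  have hfree_u : (L.addMark v 1).IsFree u := isFree_addMark _ v 1 (isFree_isolate_of_isFree _ (K.isFree_isolate_self u) v) huv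
  have hQu : (L.addMark u 1).QcolM = 9 * ∑ σ ∈ univ.filter (fun σ : V → Fin 3 => σ u = 0 ∧ σ v = 1), lbW ((L.addMark u 1).ctypeM σ) := by
    rw [(L.addMark u 1).QcolM_eq_three_mul_pin u,
      sum_filter_eq_three_mul v (fun σ : V → Fin 3 => σ u = 0) (fun σ c => by rw [Function.update_of_ne huv])
        (fun σ => lbW ((L.addMark u 1).ctypeM σ)) (fun σ c => by rw [(L.addMark u 1).ctypeM_update_of_isFree hfree_v])
        (fun _ => 1) (fun _ _ => rfl)]
    ring
  have hQv : (L.addMark v 1).QcolM = 9 * ∑ σ ∈ univ.filter (fun σ : V → Fin 3 => σ u = 0 ∧ σ v = 1), lbW ((L.addMark v 1).ctypeM σ) := by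
    rw [(L.addMark v 1).QcolM_eq_three_mul_pin v, (L.addMark v 1).sum_pin_colour_eq v 0 1,
      sum_filter_eq_three_mul u (fun σ : V → Fin 3 => σ v = 1) (fun σ c => by rw [Function.update_of_ne huv.symm])
        (fun σ => lbW ((L.addMark v 1).ctypeM σ)) (fun σ c => by rw [(L.addMark v 1).ctypeM_update_of_isFree hfree_u])
        (fun _ => 0) (fun _ _ => rfl),
      show (univ.filter fun σ : V → Fin 3 => σ v = 1 ∧ σ u = 0) = univ.filter (fun σ : V → Fin 3 => σ u = 0 ∧ σ v = 1) from
        filter_congr (fun σ _ => and_comm)]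
    ring
  rw [hT, hQu, hQv]
  ring

end TerminalIsolated

end MGraph

end Summit.CriticalPhenomena.PercolationContinuityZ3.Theorems.SunflowerPartition.Kempe
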